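import Summits.QuantumFields.BalabanUV.T4Continuum.Spine.NE2.CovariantTablePairing
import Summits.QuantumFields.BalabanUV.T4Continuum.Support.CovariantBlockAveragingPairingLaw

/-!
# T⁴ programme, spine node NE2 (U1a) — R14 W1, file 3: NORM LAWS of the two-level pairing of the TABLE averaging `Q_k(T)`:
# `‖√((Ln)^d)·(Q′(T′) − Q′⊗1)(J_L ⊗ 1) − √(n^d)·(Q(T) − Q⊗1)‖ ≤ card o·(θ + τ/n)` from the table's two-level consistency `θ` and size `τ`
# (cell `pub-balaban-gaps`, seat ne2 gen 3; plan `run/shared/lean/pub/pub-balaban-gaps/ne/NE2-R14-PLAN.md` W1)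

Row B3.b-conc's `Support/CovariantBlockAveragingPairingLaw` §3 for ARBITRARY TRANSPORTER TABLES: the entry law `norm_pairing_apply_leT`, row sums `pairing_row_leT`, column sums
`pairing_col_leT`, the rectangular Schur test `opNorm_pairDT_le`, and **`opNorm_pairing_leT`** — with the HYPOTHESIS SHAPES of row B3 now read on the table directly:
`hT2 : ∀ y μ j r t′ < L·n, ‖T′_{y,L·j+r,μ,t′} − T_{y,j,μ,⌊(r_μ+t′)/L⌋}‖ ≤ θ` (two-level consistency — for Bałaban's composed table node NE3's currency) and `hTτ : ‖T_{y,j,μ,s} − 1‖ ≤ τ`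
(`s ≤ n`).  Proofs VERBATIM from row B3 with `ctr` ↦ table entries.  What W1 still owes (file 4, successor): the tower packaging (`QcovLevT`, `EcovT`, `averagingLaws_EcovT`)
mirroring `Support/CovariantBlockAveragingTower` + `PairingLaw` §4, and `avgPertT` with its row-B3.b `PerturbationLaws`; then W2 (Bałaban's composed table) and W3 ((124) remainder).
HONEST FRAMING (T4-DAG p. 1).  Bookkeeping (Schur bounds) about TYPED operators; `T`, `T′`, `θ`, `τ` DATA/hypotheses asserted by nobody; nothing of [B7] (124)/(15) constructed
(DIVERGENCE F6 (ζ)); NOT NE2, NOT [B9] (3.16)/(3.26) as printed; NE2 (U1a) NOT PROVED; spine PROVED 0/9 unchanged; NOT continuum YM / infinite volume / mass gap / Clay.  HONEST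
DEPENDENCY: continuum YM on T⁴ ⇐ BetaPertH ∧ nine spine estimates (0/9 proved); BetaPertH ⇐ (D1) ∧ (D4) ∧ CAP+tail; G-an2-4 gates asym, D1 and NE2/3/4.  No `sorry`, no `def`.
-/

noncomputable section

open scoped BigOperators ComplexConjugate Matrix Matrix.Norms.L2Operator Kronecker
open Finset

namespace Summit.QuantumFields.BalabanUV.T4Continuum.NE2.CovariantTablePairingLaw

open Literature.MathematicalPhysics.QuantumFieldTheory.Balaban1983to89.B5Prop11Plancherel (Tor fine unitVec Cst Cst_nonneg)
open Literature.MathematicalPhysics.QuantumFieldTheory.Balaban1983to89.B5Block118 (QvOp bpt tstep tstep_zero)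
open Literature.MathematicalPhysics.QuantumFieldTheory.Balaban1983to89.B5G183RateUnitTower (lev lev_neZero)
open Literature.MathematicalPhysics.QuantumFieldTheory.Balaban1983to89.Beta.DeltaACombesThomas (sum_blocks_ite)
open Summit.QuantumFields.BalabanUV.T4Continuum
open Summit.QuantumFields.BalabanUV.T4Continuum.BalabanAveragedTowerUnit (idx norm_entry_le_opNorm one_le_lev' cast_lev')
open Summit.QuantumFields.BalabanUV.T4Continuum.BalabanAveragedTowerModes (par)
open Summit.QuantumFields.BalabanUV.T4Continuum.KingPairingPlantedLaw (JK JpcT calDalev calDalev_inv opNorm_inv_calDalev_le sqrt_facts)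
open Summit.QuantumFields.BalabanUV.T4Continuum.BlockPairingGeometry (parT JK_apply)
open Summit.QuantumFields.BalabanUV.T4Continuum.LineAveragingPairing (glue sum_glue par_bpt_glue_add_tstep tent_count sum_fun_coord cL norm_cL_le)
open Summit.QuantumFields.BalabanUV.T4Continuum.KroneckerLift
open Summit.QuantumFields.BalabanUV.T4Continuum.CovariantBlockAveraging (mul_JK_kron_apply sqrt_mul_consts sum_fun_coord' tent_transport opNorm_le_sqrt_of_schur sum_blocks_ite')
open Summit.QuantumFields.BalabanUV.T4Continuum.NE2.CovariantTableAveraging (Table QcovT QcovT_sub_kron_apply)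
open Summit.QuantumFields.BalabanUV.T4Continuum.NE2.CovariantTablePairing (pairDT pairing_applyT)

variable {d : ℕ}

section TwoLevel

variable (n L : ℕ) [NeZero n] [NeZero L] (M : Fin d → ℕ) [hM : ∀ μ, NeZero (M μ)] {o : Type*} [Fintype o] [DecidableEq o]

/-- **ENTRY LAW**: with the two-level consistency `θ` of the contour transporters and their size `τ`,
`|pairing entry| ≤ n^{−(d+1)}·(L^{−(d+1)}·θ·N + (τ/2)·(G_n + G_0))`, `N`, `G_s` the indicator counts. [folklore] -/
theorem norm_pairing_apply_leT {T' : Table d (L * n) M o} {T : Table d n M o} {θ τ : ℝ}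
    (hT2 : ∀ (y : Tor M) (μ : Fin d) (j : Fin d → Fin n) (r : Fin d → Fin L) (t' : ℕ), t' < L * n →
      ‖T' y (glue n L (j, r)) μ t' - T y j μ (((r μ : ℕ) + t') / L)‖ ≤ θ)
    (hTτ : ∀ (y : Tor M) (μ : Fin d) (j : Fin d → Fin n) (s : ℕ), s ≤ n → ‖T y j μ s - 1‖ ≤ τ)
    (b : (Tor M × Fin d) × o) (i : Tor (fine n M) × Fin d) (α' : o) :
    ‖pairDT n L M T' T b (i, α')‖
      ≤ if i.2 = b.1.2 then
          (1 / (n : ℝ) ^ (d + 1)) *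
            ((1 / (L : ℝ) ^ (d + 1)) * θ *
                ∑ j : Fin d → Fin n, ∑ r : Fin d → Fin L, ∑ t' : Fin (L * n),
                  (if bpt n M b.1.1 j + tstep (fine n M) b.1.2 (((r b.1.2 : ℕ) + t') / L) = i.1 then (1 : ℝ) else 0)
              + (τ / 2) * (∑ j : Fin d → Fin n, (if bpt n M b.1.1 j + tstep (fine n M) b.1.2 n = i.1 then (1 : ℝ) else 0)
                  + ∑ j : Fin d → Fin n, (if bpt n M b.1.1 j + tstep (fine n M) b.1.2 0 = i.1 then (1 : ℝ) else 0)))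
        else 0 := by
  have hL : 0 < L := Nat.pos_of_ne_zero (NeZero.ne L)
  rw [pairing_applyT]
  by_cases h : i.2 = b.1.2
  · rw [if_pos h, if_pos h, norm_mul, norm_div, norm_one, norm_pow, Complex.norm_natCast]
    refine mul_le_mul_of_nonneg_left ?_ (by positivity)
    refine (norm_add_le _ _).trans (add_le_add ?_ ?_)
    · rw [norm_mul, norm_div, norm_one, norm_pow, Complex.norm_natCast, mul_assoc, Finset.mul_sum]
      refine mul_le_mul_of_nonneg_left ?_ (by positivity)
      refine (norm_sum_le _ _).trans (Finset.sum_le_sum fun j _ => ?_)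
      rw [Finset.mul_sum]
      refine (norm_sum_le _ _).trans (Finset.sum_le_sum fun r _ => ?_)
      rw [Finset.mul_sum]
      refine (norm_sum_le _ _).trans (Finset.sum_le_sum fun t' _ => ?_)
      split_ifs
      · rw [mul_one]
        exact (norm_entry_le_opNorm _ _ _).trans (hT2 _ _ _ _ _ t'.isLt)
      · simp
    · rw [norm_mul]
      have hA : ∀ j : Fin d → Fin n,
          ‖(if bpt n M b.1.1 j + tstep (fine n M) b.1.2 n = i.1 then (T b.1.1 j b.1.2 n - 1) b.2 α' else 0)
              - (if bpt n M b.1.1 j + tstep (fine n M) b.1.2 0 = i.1 then (T b.1.1 j b.1.2 0 - 1) b.2 α' else 0)‖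
            ≤ τ * (if bpt n M b.1.1 j + tstep (fine n M) b.1.2 n = i.1 then (1 : ℝ) else 0)
              + τ * (if bpt n M b.1.1 j + tstep (fine n M) b.1.2 0 = i.1 then (1 : ℝ) else 0) := by
        intro j
        refine (norm_sub_le _ _).trans (add_le_add ?_ ?_)
        · split_ifs
          · rw [mul_one]; exact (norm_entry_le_opNorm _ _ _).trans (hTτ _ _ _ _ le_rfl)
          · simp
        · split_ifs
          · rw [mul_one]; exact (norm_entry_le_opNorm _ _ _).trans (hTτ _ _ _ _ (Nat.zero_le _))
          · simp
      calc _ ≤ (1 / 2) * ∑ j : Fin d → Fin n,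
              (τ * (if bpt n M b.1.1 j + tstep (fine n M) b.1.2 n = i.1 then (1 : ℝ) else 0)
                + τ * (if bpt n M b.1.1 j + tstep (fine n M) b.1.2 0 = i.1 then (1 : ℝ) else 0)) :=
            mul_le_mul (norm_cL_le L hL) ((norm_sum_le _ _).trans (Finset.sum_le_sum fun j _ => hA j)) (norm_nonneg _)
              (by norm_num)
        _ = _ := by rw [Finset.sum_add_distrib, ← Finset.mul_sum, ← Finset.mul_sum]; ring
  · rw [if_neg h, if_neg h, norm_zero]


/-- **ROW SUMS** of the two-level pairing matrix: `≤ card o·(θ + τ/n)`. [folklore] -/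
theorem pairing_row_leT {T' : Table d (L * n) M o} {T : Table d n M o} {θ τ : ℝ}
    (hT2 : ∀ (y : Tor M) (μ : Fin d) (j : Fin d → Fin n) (r : Fin d → Fin L) (t' : ℕ), t' < L * n →
      ‖T' y (glue n L (j, r)) μ t' - T y j μ (((r μ : ℕ) + t') / L)‖ ≤ θ)
    (hTτ : ∀ (y : Tor M) (μ : Fin d) (j : Fin d → Fin n) (s : ℕ), s ≤ n → ‖T y j μ s - 1‖ ≤ τ)
    (b : (Tor M × Fin d) × o) :
    ∑ c : (Tor (fine n M) × Fin d) × o, ‖pairDT n L M T' T b c‖ ≤ Fintype.card o * (θ + τ / n) := by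
  have hn : (n : ℝ) ≠ 0 := by exact_mod_cast NeZero.ne n
  have hLr : (L : ℝ) ≠ 0 := by exact_mod_cast NeZero.ne L
  have hN : ∑ x : Tor (fine n M), ∑ j : Fin d → Fin n, ∑ r : Fin d → Fin L, ∑ t' : Fin (L * n),
      (if bpt n M b.1.1 j + tstep (fine n M) b.1.2 (((r b.1.2 : ℕ) + t') / L) = x then (1 : ℝ) else 0)
      = (n : ℝ) ^ d * ((L : ℝ) ^ d * (L * n)) := by
    rw [Finset.sum_comm]
    have e : ∀ j : Fin d → Fin n, ∑ x : Tor (fine n M), ∑ r : Fin d → Fin L, ∑ t' : Fin (L * n),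
        (if bpt n M b.1.1 j + tstep (fine n M) b.1.2 (((r b.1.2 : ℕ) + t') / L) = x then (1 : ℝ) else 0) = (L : ℝ) ^ d * (L * n) := by
      intro j
      rw [Finset.sum_comm]
      have e2 : ∀ r : Fin d → Fin L, ∑ x : Tor (fine n M), ∑ t' : Fin (L * n),
          (if bpt n M b.1.1 j + tstep (fine n M) b.1.2 (((r b.1.2 : ℕ) + t') / L) = x then (1 : ℝ) else 0) = L * n := by
        intro r
        rw [Finset.sum_comm]
        simp only [Finset.sum_ite_eq, Finset.mem_univ, if_true, Finset.sum_const, Finset.card_univ, Fintype.card_fin, nsmul_eq_mul,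
          mul_one]
        push_cast; ring
      rw [Finset.sum_congr rfl fun r _ => e2 r, Finset.sum_const, Finset.card_univ]
      simp only [Fintype.card_fun, Fintype.card_fin, nsmul_eq_mul]
      push_cast; ring
    rw [Finset.sum_congr rfl fun j _ => e j, Finset.sum_const, Finset.card_univ]
    simp only [Fintype.card_fun, Fintype.card_fin, nsmul_eq_mul]
    push_cast; ring
  have hG : ∀ s : ℕ, ∑ x : Tor (fine n M), ∑ j : Fin d → Fin n, (if bpt n M b.1.1 j + tstep (fine n M) b.1.2 s = x then (1 : ℝ) else 0)
      = (n : ℝ) ^ d := by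
    intro s
    rw [Finset.sum_comm]
    simp only [Finset.sum_ite_eq, Finset.mem_univ, if_true, Finset.sum_const, Finset.card_univ, Fintype.card_fun, Fintype.card_fin,
      nsmul_eq_mul, mul_one]
    push_cast; ring
  rw [Fintype.sum_prod_type]
  calc ∑ i : Tor (fine n M) × Fin d, ∑ α' : o, ‖pairDT n L M T' T b (i, α')‖
      ≤ ∑ i : Tor (fine n M) × Fin d, ∑ _α' : o, (if i.2 = b.1.2 then
          (1 / (n : ℝ) ^ (d + 1)) *
            ((1 / (L : ℝ) ^ (d + 1)) * θ *
                ∑ j : Fin d → Fin n, ∑ r : Fin d → Fin L, ∑ t' : Fin (L * n),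
                  (if bpt n M b.1.1 j + tstep (fine n M) b.1.2 (((r b.1.2 : ℕ) + t') / L) = i.1 then (1 : ℝ) else 0)
              + (τ / 2) * (∑ j : Fin d → Fin n, (if bpt n M b.1.1 j + tstep (fine n M) b.1.2 n = i.1 then (1 : ℝ) else 0)
                  + ∑ j : Fin d → Fin n, (if bpt n M b.1.1 j + tstep (fine n M) b.1.2 0 = i.1 then (1 : ℝ) else 0)))
          else 0) :=
        Finset.sum_le_sum fun i _ => Finset.sum_le_sum fun α' _ => norm_pairing_apply_leT n L M hT2 hTτ b i α'
    _ = Fintype.card o * (θ + τ / n) := by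
        simp only [Finset.sum_const, Finset.card_univ, nsmul_eq_mul]
        rw [← Finset.mul_sum, Fintype.sum_prod_type]
        simp only [Finset.sum_ite_eq', Finset.mem_univ, if_true]
        rw [← Finset.mul_sum, Finset.sum_add_distrib, ← Finset.mul_sum, ← Finset.mul_sum, Finset.sum_add_distrib, hN, hG, hG]
        field_simp
        ring

/-- **COLUMN SUMS** of the two-level pairing matrix: `≤ card o·(θ + τ/n)·n^{−d}`. [folklore] -/
theorem pairing_col_leT {T' : Table d (L * n) M o} {T : Table d n M o} {θ τ : ℝ}
    (hT2 : ∀ (y : Tor M) (μ : Fin d) (j : Fin d → Fin n) (r : Fin d → Fin L) (t' : ℕ), t' < L * n →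
      ‖T' y (glue n L (j, r)) μ t' - T y j μ (((r μ : ℕ) + t') / L)‖ ≤ θ)
    (hTτ : ∀ (y : Tor M) (μ : Fin d) (j : Fin d → Fin n) (s : ℕ), s ≤ n → ‖T y j μ s - 1‖ ≤ τ)
    (i : Tor (fine n M) × Fin d) (α' : o) :
    ∑ b : (Tor M × Fin d) × o, ‖pairDT n L M T' T b (i, α')‖ ≤ Fintype.card o * (θ + τ / n) * (1 / (n : ℝ) ^ d) := by
  have hn : (n : ℝ) ≠ 0 := by exact_mod_cast NeZero.ne n
  have hLr : (L : ℝ) ≠ 0 := by exact_mod_cast NeZero.ne L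
  have hN : ∑ y : Tor M, ∑ j : Fin d → Fin n, ∑ r : Fin d → Fin L, ∑ t' : Fin (L * n),
      (if bpt n M y j + tstep (fine n M) i.2 (((r i.2 : ℕ) + t') / L) = i.1 then (1 : ℝ) else 0) = (L : ℝ) ^ d * (L * n) := by
    have e : ∀ y : Tor M, ∑ j : Fin d → Fin n, ∑ r : Fin d → Fin L, ∑ t' : Fin (L * n),
        (if bpt n M y j + tstep (fine n M) i.2 (((r i.2 : ℕ) + t') / L) = i.1 then (1 : ℝ) else 0)
        = ∑ r : Fin d → Fin L, ∑ t' : Fin (L * n), ∑ j : Fin d → Fin n,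
          (if bpt n M y j + tstep (fine n M) i.2 (((r i.2 : ℕ) + t') / L) = i.1 then (1 : ℝ) else 0) := by
      intro y
      rw [Finset.sum_comm]
      exact Finset.sum_congr rfl fun r _ => Finset.sum_comm
    rw [Finset.sum_congr rfl fun y _ => e y, Finset.sum_comm]
    have e2 : ∀ r : Fin d → Fin L, ∑ y : Tor M, ∑ t' : Fin (L * n), ∑ j : Fin d → Fin n,
        (if bpt n M y j + tstep (fine n M) i.2 (((r i.2 : ℕ) + t') / L) = i.1 then (1 : ℝ) else 0) = L * n := by
      intro r
      rw [Finset.sum_comm]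
      simp_rw [sum_blocks_ite']
      rw [Finset.sum_const, Finset.card_univ, Fintype.card_fin, nsmul_eq_mul, mul_one]
      push_cast; ring
    rw [Finset.sum_congr rfl fun r _ => e2 r, Finset.sum_const, Finset.card_univ]
    simp only [Fintype.card_fun, Fintype.card_fin, nsmul_eq_mul]
    push_cast; ring
  rw [Fintype.sum_prod_type]
  calc ∑ b1 : Tor M × Fin d, ∑ α : o, ‖pairDT n L M T' T (b1, α) (i, α')‖
      ≤ ∑ b1 : Tor M × Fin d, ∑ _α : o, (if i.2 = b1.2 then
          (1 / (n : ℝ) ^ (d + 1)) *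
            ((1 / (L : ℝ) ^ (d + 1)) * θ *
                ∑ j : Fin d → Fin n, ∑ r : Fin d → Fin L, ∑ t' : Fin (L * n),
                  (if bpt n M b1.1 j + tstep (fine n M) b1.2 (((r b1.2 : ℕ) + t') / L) = i.1 then (1 : ℝ) else 0)
              + (τ / 2) * (∑ j : Fin d → Fin n, (if bpt n M b1.1 j + tstep (fine n M) b1.2 n = i.1 then (1 : ℝ) else 0)
                  + ∑ j : Fin d → Fin n, (if bpt n M b1.1 j + tstep (fine n M) b1.2 0 = i.1 then (1 : ℝ) else 0)))
          else 0) :=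
        Finset.sum_le_sum fun b1 _ => Finset.sum_le_sum fun α _ => norm_pairing_apply_leT n L M hT2 hTτ (b1, α) i α'
    _ = Fintype.card o * (θ + τ / n) * (1 / (n : ℝ) ^ d) := by
        simp only [Finset.sum_const, Finset.card_univ, nsmul_eq_mul]
        rw [← Finset.mul_sum, Fintype.sum_prod_type]
        simp only [Finset.sum_ite_eq, Finset.mem_univ, if_true]
        rw [← Finset.mul_sum, Finset.sum_add_distrib, ← Finset.mul_sum, ← Finset.mul_sum, Finset.sum_add_distrib, hN,
          sum_blocks_ite', sum_blocks_ite']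
        field_simp
        ring

/-- **THE TWO-LEVEL PAIRING BOUND (Schur)**: `‖D‖ ≤ card o·(θ + τ/n)·(√(n^d))⁻¹`. [folklore] -/
theorem opNorm_pairDT_le {T' : Table d (L * n) M o} {T : Table d n M o} {θ τ : ℝ} (hθ : 0 ≤ θ) (hτ : 0 ≤ τ)
    (hT2 : ∀ (y : Tor M) (μ : Fin d) (j : Fin d → Fin n) (r : Fin d → Fin L) (t' : ℕ), t' < L * n →
      ‖T' y (glue n L (j, r)) μ t' - T y j μ (((r μ : ℕ) + t') / L)‖ ≤ θ)
    (hTτ : ∀ (y : Tor M) (μ : Fin d) (j : Fin d → Fin n) (s : ℕ), s ≤ n → ‖T y j μ s - 1‖ ≤ τ) :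
    ‖pairDT n L M T' T‖ ≤ Fintype.card o * (θ + τ / n) * (Real.sqrt ((n : ℝ) ^ d))⁻¹ := by
  have hn : (0 : ℝ) < (n : ℝ) ^ d := pow_pos (by exact_mod_cast Nat.pos_of_ne_zero (NeZero.ne n)) d
  have hK : 0 ≤ (Fintype.card o : ℝ) * (θ + τ / n) := by positivity
  refine (opNorm_le_sqrt_of_schur (R := Fintype.card o * (θ + τ / n)) (C := Fintype.card o * (θ + τ / n) * (1 / (n : ℝ) ^ d)) _ hK
    (by positivity) (pairing_row_leT n L M hT2 hTτ) (fun c => by obtain ⟨i, α'⟩ := c; exact pairing_col_leT n L M hT2 hTτ i α')).trans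
    (le_of_eq ?_)
  rw [show (Fintype.card o : ℝ) * (θ + τ / n) * (Fintype.card o * (θ + τ / n) * (1 / (n : ℝ) ^ d))
      = (Fintype.card o * (θ + τ / n)) ^ 2 * ((n : ℝ) ^ d)⁻¹ by ring,
    Real.sqrt_mul (sq_nonneg _), Real.sqrt_sq hK, Real.sqrt_inv]

/-- **THE TWO-LEVEL PAIRING OF THE SCALED TRANSPORT ERRORS**:
`‖√((Ln)^d)·(Q′(R′) − Q′ ⊗ 1)(J_L ⊗ 1) − √(n^d)·(Q(R) − Q ⊗ 1)‖ ≤ card o·(θ + τ/n)`. [folklore] -/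
theorem opNorm_pairing_leT {T' : Table d (L * n) M o} {T : Table d n M o} {θ τ : ℝ} (hθ : 0 ≤ θ) (hτ : 0 ≤ τ)
    (hT2 : ∀ (y : Tor M) (μ : Fin d) (j : Fin d → Fin n) (r : Fin d → Fin L) (t' : ℕ), t' < L * n →
      ‖T' y (glue n L (j, r)) μ t' - T y j μ (((r μ : ℕ) + t') / L)‖ ≤ θ)
    (hTτ : ∀ (y : Tor M) (μ : Fin d) (j : Fin d → Fin n) (s : ℕ), s ≤ n → ‖T y j μ s - 1‖ ≤ τ) :
    ‖(((Real.sqrt ((((L * n : ℕ)) : ℝ) ^ d)) : ℝ) : ℂ)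
        • ((QcovT (L * n) M T' - QvOp (L * n) M ⊗ₖ (1 : Matrix o o ℂ)) * (JK n L M ⊗ₖ (1 : Matrix o o ℂ)))
      - (((Real.sqrt ((n : ℝ) ^ d)) : ℝ) : ℂ) • (QcovT n M T - QvOp n M ⊗ₖ (1 : Matrix o o ℂ))‖
      ≤ Fintype.card o * (θ + τ / n) := by
  have hn0 : (0 : ℝ) ≤ (n : ℝ) ^ d := pow_nonneg (Nat.cast_nonneg _) d
  have hpos : 0 < Real.sqrt ((n : ℝ) ^ d) := Real.sqrt_pos.mpr (pow_pos (by exact_mod_cast Nat.pos_of_ne_zero (NeZero.ne n)) d)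
  have hsq : Real.sqrt ((((L * n : ℕ)) : ℝ) ^ d) = Real.sqrt ((n : ℝ) ^ d) * Real.sqrt ((L : ℝ) ^ d) := by
    rw [← Real.sqrt_mul hn0]; congr 1; push_cast; ring
  have e : (((Real.sqrt ((((L * n : ℕ)) : ℝ) ^ d)) : ℝ) : ℂ)
        • ((QcovT (L * n) M T' - QvOp (L * n) M ⊗ₖ (1 : Matrix o o ℂ)) * (JK n L M ⊗ₖ (1 : Matrix o o ℂ)))
      - (((Real.sqrt ((n : ℝ) ^ d)) : ℝ) : ℂ) • (QcovT n M T - QvOp n M ⊗ₖ (1 : Matrix o o ℂ))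
      = (((Real.sqrt ((n : ℝ) ^ d)) : ℝ) : ℂ) • pairDT n L M T' T := by
    conv_rhs => rw [pairDT, smul_sub, smul_smul, ← Complex.ofReal_mul, ← hsq]
  rw [e, norm_smul, Complex.norm_real, Real.norm_of_nonneg hpos.le]
  calc Real.sqrt ((n : ℝ) ^ d) * ‖pairDT n L M T' T‖
      ≤ Real.sqrt ((n : ℝ) ^ d) * (Fintype.card o * (θ + τ / n) * (Real.sqrt ((n : ℝ) ^ d))⁻¹) :=
        mul_le_mul_of_nonneg_left (opNorm_pairDT_le n L M hθ hτ hT2 hTτ) hpos.le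
    _ = Fintype.card o * (θ + τ / n) := by field_simp

end TwoLevel

end Summit.QuantumFields.BalabanUV.T4Continuum.NE2.CovariantTablePairingLaw

end
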